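import Literature.NumberTheory.EllipticCurves.Curve2000IsogenyChain
import Literature.NumberTheory.EllipticCurves.Curve2000SelmerCertificates
import Literature.NumberTheory.EllipticCurves.TwoIsogenyCasselsParity
import Literature.NumberTheory.EllipticCurves.TwoIsogenyDescentIndex
import HarnessLib

/-!
# The `2`-isogeny descent two steps from `E₀` does NOT close: `#Ш(V₀/ℚ)[φ] = 2` and `1 ≤ #Ш(M₁₀/ℚ)[φ] ≤ 2`, so
# `2 ≤ #Ш(V₀/ℚ)[2] ≤ 4` — the bracket that only Cassels–Tate parity closes (Summits `…OddDoorHiddenClass`)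

Topic `NumberTheory/EllipticCurves`. Fourth file of the cell `Curve2000*` (seat bsd-line-spt-p1 g13). For the pair
`φ : V₀ = [0, 115, 0, 15625/4, 0] → M₁₀ = [0, −230, 0, −2400, 0]` (`V₀ ≅ W = [0, 460, 0, 62500, 0]`, two `2`-isogeny steps from the
sharp curve `E₀`, `Curve2000IsogenyChain`; rank `0`, `t_2 = 0`):

* §1 `S(−230, −2400) ⊆ {±1, ±6, ±10, ±15}` (the other eight divisor classes of `−2400` die modulo `25` or `125`) and, with the
  seven certified classes of `Curve2000SelmerCertificates` and `1`, **`dim₂ S(−230, −2400) = 3`**; `S(460, 62500) ⊆ {1, 10}`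
  (`−1, 2, 5, −10` modulo `3`; `−2, −5` modulo `16`), **`dim₂ S'(−230,−2400) ≤ 1`** — the class `10` is NOT certified here
  (no local points are exhibited for it; the Summits sequel proves it lies in `S` by PARITY).
* §2 `#α(M₁₀(ℚ)) = 4` (`[1], [−6], [−10], [15]` from the three rational `2`-torsion points; `= 4` by `#α·#ᾱ = 2^{rank+2} = 4`),
  `#ᾱ(W(ℚ)) = 1`.
* §3 **`#(Ш(V₀/ℚ) ∩ im Ξ_{V₀}) = 2`** (`= #Ш(V₀)[φ] = 2^3/4`, `two_pow_twoIsogenySelmerRank_eq_natCard_mul_halfModel`) and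
  **`1 ≤ #(Ш(M₁₀/ℚ) ∩ im Ξ_{M₁₀}) ≤ 2`** (`= #Ш(M₁₀)[φ̂-side] = 2^{dim₂ S(460,62500)}`): the descent brackets `#Ш(V₀/ℚ)[2] ∈ [2, 4]`
  and cannot decide it.

Everything is re-verified by the kernel. Theorems only; no definitions, no named facts.

## References

* [SilvermanAEC2009] J. H. Silverman, *AEC*, 2nd ed.: Prop. X.4.9, Example X.4.10, Thm. X.4.2(a).
* [SilvermanTate2015] J. H. Silverman, J. Tate, *Rational Points on Elliptic Curves*, §3.5–§3.6.
-/

noncomputable section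

open scoped Classical

namespace Literature.NumberTheory.EllipticCurves

namespace Curve2000

open _root_.WeierstrassCurve _root_.WeierstrassCurve.Affine

/-! ## §1 The two Selmer sets of the pair `V₀ → M₁₀` -/

/-- `S(-230, -2400)` does not contain: `d = 5, -5, 30, -30` modulo `25`; `d = 2, -2, 3, -3` modulo `125` (no solution of either chart modulo the stated prime power; the pair two steps from `E₀`).
[cite: SilvermanAEC2009, Example X.4.10 (the congruence method)] -/
theorem not_mem_S_M10 :
    (2 : ℤ) ∉ twoIsogenySelmerGroup (-230) (-2400) ∧
      (-2 : ℤ) ∉ twoIsogenySelmerGroup (-230) (-2400) ∧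
      (3 : ℤ) ∉ twoIsogenySelmerGroup (-230) (-2400) ∧
      (-3 : ℤ) ∉ twoIsogenySelmerGroup (-230) (-2400) ∧
      (5 : ℤ) ∉ twoIsogenySelmerGroup (-230) (-2400) ∧
      (-5 : ℤ) ∉ twoIsogenySelmerGroup (-230) (-2400) ∧
      (30 : ℤ) ∉ twoIsogenySelmerGroup (-230) (-2400) ∧
      (-30 : ℤ) ∉ twoIsogenySelmerGroup (-230) (-2400) := by
  have hB : (-2400 : ℤ) ≠ 0 := by norm_num
  haveI : Fact (Nat.Prime 5) := ⟨by norm_num⟩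
  refine ⟨?_, ?_, ?_, ?_, ?_, ?_, ?_, ?_⟩
  · refine Carrier6137.not_mem_twoIsogenySelmerGroup_of_not_isSoluble hB 5 ?_
    rw [show (-2400 : ℤ) / 2 = -1200 by norm_num]
    exact Carrier6137.not_isSoluble_padic_twoIsogenyQuartic_of_zmodPow 3 (by decide +kernel)
  · refine Carrier6137.not_mem_twoIsogenySelmerGroup_of_not_isSoluble hB 5 ?_
    rw [show (-2400 : ℤ) / -2 = 1200 by norm_num]
    exact Carrier6137.not_isSoluble_padic_twoIsogenyQuartic_of_zmodPow 3 (by decide +kernel)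
  · refine Carrier6137.not_mem_twoIsogenySelmerGroup_of_not_isSoluble hB 5 ?_
    rw [show (-2400 : ℤ) / 3 = -800 by norm_num]
    exact Carrier6137.not_isSoluble_padic_twoIsogenyQuartic_of_zmodPow 3 (by decide +kernel)
  · refine Carrier6137.not_mem_twoIsogenySelmerGroup_of_not_isSoluble hB 5 ?_
    rw [show (-2400 : ℤ) / -3 = 800 by norm_num]
    exact Carrier6137.not_isSoluble_padic_twoIsogenyQuartic_of_zmodPow 3 (by decide +kernel)
  · refine Carrier6137.not_mem_twoIsogenySelmerGroup_of_not_isSoluble hB 5 ?_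
    rw [show (-2400 : ℤ) / 5 = -480 by norm_num]
    exact Carrier6137.not_isSoluble_padic_twoIsogenyQuartic_of_zmodPow 2 (by decide)
  · refine Carrier6137.not_mem_twoIsogenySelmerGroup_of_not_isSoluble hB 5 ?_
    rw [show (-2400 : ℤ) / -5 = 480 by norm_num]
    exact Carrier6137.not_isSoluble_padic_twoIsogenyQuartic_of_zmodPow 2 (by decide)
  · refine Carrier6137.not_mem_twoIsogenySelmerGroup_of_not_isSoluble hB 5 ?_
    rw [show (-2400 : ℤ) / 30 = -80 by norm_num]
    exact Carrier6137.not_isSoluble_padic_twoIsogenyQuartic_of_zmodPow 2 (by decide)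
  · refine Carrier6137.not_mem_twoIsogenySelmerGroup_of_not_isSoluble hB 5 ?_
    rw [show (-2400 : ℤ) / -30 = 80 by norm_num]
    exact Carrier6137.not_isSoluble_padic_twoIsogenyQuartic_of_zmodPow 2 (by decide)

/-- A squarefree integer dividing `-2400` is `±` a divisor of `30`. [cite: SilvermanAEC2009, Prop. X.4.9] -/
private theorem mem_of_dvd_bM10 {d : ℤ} (hsq : Squarefree d) (hd : d ∣ (-2400 : ℤ)) :
    d ∈ ({1, -1, 2, -2, 3, -3, 5, -5, 6, -6, 10, -10, 15, -15, 30, -30} : Finset ℤ) := by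
  have hrad : d ∣ 30 := by
    have h5 : d ∣ (30 : ℤ) ^ 5 := dvd_trans hd ⟨-10125, by norm_num⟩
    exact (hsq.dvd_pow_iff_dvd (by norm_num)).mp h5
  have h1 : d.natAbs ∣ 30 := by
    have := Int.natAbs_dvd_natAbs.mpr hrad
    simpa using this
  have h2 : d.natAbs ∈ Nat.divisors 30 := Nat.mem_divisors.mpr ⟨h1, by norm_num⟩
  rw [show Nat.divisors 30 = {1, 2, 3, 5, 6, 10, 15, 30} by decide +kernel] at h2
  simp only [Finset.mem_insert, Finset.mem_singleton] at h2 ⊢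
  rcases Int.natAbs_eq d with h | h <;> rw [h] <;>
    rcases h2 with h2 | h2 | h2 | h2 | h2 | h2 | h2 | h2 <;> simp [h2]

/-- **`S(-230, -2400) ⊆ {1, -1, 6, -6, 10, -10, 15, -15}`**. [cite: SilvermanAEC2009, Prop. X.4.9 and Example X.4.10] -/
theorem twoIsogenySelmerGroup_M10_subset :
    twoIsogenySelmerGroup (-230) (-2400) ⊆ ({1, -1, 6, -6, 10, -10, 15, -15} : Finset ℤ) := by
  intro d hd
  obtain ⟨hsq, hdvd, -⟩ := (mem_twoIsogenySelmerGroup_iff (a := -230) (by norm_num : (-2400 : ℤ) ≠ 0)).mp hd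
  have hmem := mem_of_dvd_bM10 hsq hdvd
  obtain ⟨h2, hm2, h3, hm3, h5, hm5, h30, hm30⟩ := not_mem_S_M10
  simp only [Finset.mem_insert, Finset.mem_singleton] at hmem ⊢
  rcases hmem with rfl | rfl | rfl | rfl | rfl | rfl | rfl | rfl | rfl | rfl | rfl | rfl | rfl | rfl | rfl | rfl
  · simp
  · simp
  · exact absurd hd h2
  · exact absurd hd hm2
  · exact absurd hd h3
  · exact absurd hd hm3
  · exact absurd hd h5
  · exact absurd hd hm5
  · simp
  · simp
  · simp
  · simp
  · simp
  · simp
  · exact absurd hd h30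
  · exact absurd hd hm30

/-- `S(460, 62500)` does not contain: `d = -1, 2, 5, -10` modulo `3`; `d = -2, -5` modulo `16` (no solution of either chart modulo the stated prime power; dual side).
[cite: SilvermanAEC2009, Example X.4.10 (the congruence method)] -/
theorem not_mem_S_W :
    (-1 : ℤ) ∉ twoIsogenySelmerGroup (460) (62500) ∧
      (2 : ℤ) ∉ twoIsogenySelmerGroup (460) (62500) ∧
      (-2 : ℤ) ∉ twoIsogenySelmerGroup (460) (62500) ∧
      (5 : ℤ) ∉ twoIsogenySelmerGroup (460) (62500) ∧
      (-5 : ℤ) ∉ twoIsogenySelmerGroup (460) (62500) ∧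
      (-10 : ℤ) ∉ twoIsogenySelmerGroup (460) (62500) := by
  have hB : (62500 : ℤ) ≠ 0 := by norm_num
  haveI : Fact (Nat.Prime 2) := ⟨by norm_num⟩
  haveI : Fact (Nat.Prime 3) := ⟨by norm_num⟩
  refine ⟨?_, ?_, ?_, ?_, ?_, ?_⟩
  · refine Carrier6137.not_mem_twoIsogenySelmerGroup_of_not_isSoluble hB 3 ?_
    rw [show (62500 : ℤ) / -1 = -62500 by norm_num]
    exact Carrier6137.not_isSoluble_padic_twoIsogenyQuartic_of_zmodPow 1 (by decide)
  · refine Carrier6137.not_mem_twoIsogenySelmerGroup_of_not_isSoluble hB 3 ?_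
    rw [show (62500 : ℤ) / 2 = 31250 by norm_num]
    exact Carrier6137.not_isSoluble_padic_twoIsogenyQuartic_of_zmodPow 1 (by decide)
  · refine Carrier6137.not_mem_twoIsogenySelmerGroup_of_not_isSoluble hB 2 ?_
    rw [show (62500 : ℤ) / -2 = -31250 by norm_num]
    exact Carrier6137.not_isSoluble_padic_twoIsogenyQuartic_of_zmodPow 4 (by decide)
  · refine Carrier6137.not_mem_twoIsogenySelmerGroup_of_not_isSoluble hB 3 ?_
    rw [show (62500 : ℤ) / 5 = 12500 by norm_num]
    exact Carrier6137.not_isSoluble_padic_twoIsogenyQuartic_of_zmodPow 1 (by decide)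
  · refine Carrier6137.not_mem_twoIsogenySelmerGroup_of_not_isSoluble hB 2 ?_
    rw [show (62500 : ℤ) / -5 = -12500 by norm_num]
    exact Carrier6137.not_isSoluble_padic_twoIsogenyQuartic_of_zmodPow 4 (by decide)
  · refine Carrier6137.not_mem_twoIsogenySelmerGroup_of_not_isSoluble hB 3 ?_
    rw [show (62500 : ℤ) / -10 = -6250 by norm_num]
    exact Carrier6137.not_isSoluble_padic_twoIsogenyQuartic_of_zmodPow 1 (by decide)

/-- A squarefree integer dividing `62500` is `±` a divisor of `10`. [cite: SilvermanAEC2009, Prop. X.4.9] -/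
private theorem mem_of_dvd_bW {d : ℤ} (hsq : Squarefree d) (hd : d ∣ (62500 : ℤ)) :
    d ∈ ({1, -1, 2, -2, 5, -5, 10, -10} : Finset ℤ) := by
  have hrad : d ∣ 10 := by
    have h5 : d ∣ (10 : ℤ) ^ 6 := dvd_trans hd ⟨16, by norm_num⟩
    exact (hsq.dvd_pow_iff_dvd (by norm_num)).mp h5
  have h1 : d.natAbs ∣ 10 := by
    have := Int.natAbs_dvd_natAbs.mpr hrad
    simpa using this
  have h2 : d.natAbs ∈ Nat.divisors 10 := Nat.mem_divisors.mpr ⟨h1, by norm_num⟩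
  rw [show Nat.divisors 10 = {1, 2, 5, 10} by decide +kernel] at h2
  simp only [Finset.mem_insert, Finset.mem_singleton] at h2 ⊢
  rcases Int.natAbs_eq d with h | h <;> rw [h] <;>
    rcases h2 with h2 | h2 | h2 | h2 <;> simp [h2]

/-- **`S(460, 62500) ⊆ {1, 10}`**. [cite: SilvermanAEC2009, Prop. X.4.9 and Example X.4.10] -/
theorem twoIsogenySelmerGroup_W_subset :
    twoIsogenySelmerGroup (460) (62500) ⊆ ({1, 10} : Finset ℤ) := by
  intro d hd
  obtain ⟨hsq, hdvd, -⟩ := (mem_twoIsogenySelmerGroup_iff (a := 460) (by norm_num : (62500 : ℤ) ≠ 0)).mp hd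
  have hmem := mem_of_dvd_bW hsq hdvd
  obtain ⟨hm1, h2, hm2, h5, hm5, hm10⟩ := not_mem_S_W
  simp only [Finset.mem_insert, Finset.mem_singleton] at hmem ⊢
  rcases hmem with rfl | rfl | rfl | rfl | rfl | rfl | rfl | rfl
  · simp
  · exact absurd hd hm1
  · exact absurd hd h2
  · exact absurd hd hm2
  · exact absurd hd h5
  · exact absurd hd hm5
  · simp
  · exact absurd hd hm10

/-- **`dim₂ S(−230, −2400) = 3`**: `⊆` an `8`-set (§1) and `⊇` the `8` classes `1, ±… ` certified in `Curve2000SelmerCertificates`.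
[cite: SilvermanAEC2009, Prop. X.4.9] -/
theorem twoIsogenySelmerRank_M10_eq : twoIsogenySelmerRank (-230) (-2400) = 3 := by
  have hcard : (twoIsogenySelmerGroup (-230) (-2400)).card = 8 := by
    refine le_antisymm ((Finset.card_le_card twoIsogenySelmerGroup_M10_subset).trans (by decide)) ?_
    have hsub : ({1, -1, 6, -6, 10, -10, 15, -15} : Finset ℤ) ⊆ twoIsogenySelmerGroup (-230) (-2400) := by
      intro d hd
      simp only [Finset.mem_insert, Finset.mem_singleton] at hd
      rcases hd with rfl | rfl | rfl | rfl | rfl | rfl | rfl | rfl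
      · exact one_mem_twoIsogenySelmerGroup (-230) (by norm_num)
      · exact mem_S_m1
      · exact mem_S_6
      · exact mem_S_m6
      · exact mem_S_10
      · exact mem_S_m10
      · exact mem_S_15
      · exact mem_S_m15
    exact le_trans (by decide) (Finset.card_le_card hsub)
  have h := two_pow_twoIsogenySelmerRank_eq_card habM10
  rw [hcard] at h
  have h' : 2 ^ twoIsogenySelmerRank (-230) (-2400) = 2 ^ 3 := by rw [h]; norm_num
  exact Nat.pow_right_injective (le_refl 2) h'

/-- **`dim₂ S'(−230, −2400) = dim₂ S(460, 62500) ≤ 1`.** [cite: SilvermanAEC2009, Prop. X.4.9] -/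
theorem twoIsogenySelmerRank'_M10_le : twoIsogenySelmerRank' (-230) (-2400) ≤ 1 := by
  apply (Nat.pow_le_pow_iff_right (by norm_num : 1 < 2)).mp
  rw [two_pow_twoIsogenySelmerRank'_eq_card habM10, twoIsogenySelmerGroup'_eq,
    show (-2 * (-230) : ℤ) = 460 by norm_num, show ((-230 : ℤ) ^ 2 - 4 * (-2400) : ℤ) = 62500 by norm_num, pow_one]
  exact (Finset.card_le_card twoIsogenySelmerGroup_W_subset).trans (by decide)

/-! ## §2 The point images: `#α(M₁₀(ℚ)) = 4`, `#ᾱ(W(ℚ)) = 1` -/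


/-- Squarefree integers with the same square class in `ℚ*/ℚ*²` are equal. [cite: SilvermanTate2015, §3.5] -/
private theorem eq_of_sqClass_intCast_eq {d₁ d₂ : ℤ} (h₁ : Squarefree d₁) (h₂ : Squarefree d₂)
    (he : sqClass (d₁ : ℚ) = sqClass (d₂ : ℚ)) : d₁ = d₂ := by
  have h0₁ : (d₁ : ℚ) ≠ 0 := by exact_mod_cast h₁.ne_zero
  have h0₂ : (d₂ : ℚ) ≠ 0 := by exact_mod_cast h₂.ne_zero
  have h1 : sqClass ((d₁ : ℚ) * d₂) = 1 := by rw [sqClass_mul h0₁ h0₂, he, SqUnits.mul_self]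
  obtain ⟨u, hu⟩ := (sqClass_eq_one_iff (mul_ne_zero h0₁ h0₂)).mp h1
  obtain ⟨m, hm⟩ : IsSquare (d₁ * d₂) := by
    rw [← Rat.isSquare_intCast_iff]
    exact ⟨u, by push_cast; rw [hu, pow_two]⟩
  exact eq_of_squarefree_of_mul_eq_sq h₁ h₂ (m := m) (by rw [hm, pow_two])

/-- Squarefreeness of a (small) integer from the factorisation of its absolute value. [cite: SilvermanTate2015, §3.5] -/
private theorem squarefree_int_of_natAbs {d : ℤ} {n : ℕ} (h : d.natAbs = n) (hn : n ≠ 0)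
    (hnd : n.primeFactorsList.Nodup) : Squarefree d :=
  Int.squarefree_natAbs.mp (h ▸ (Nat.squarefree_iff_nodup_primeFactorsList hn).mpr hnd)

/-- `[x t²] = [x]` in `ℚ*/ℚ*²`. [cite: SilvermanTate2015, §3.5] -/
private theorem sqClass_mul_sq' {x t : ℚ} (hx : x ≠ 0) (ht : t ≠ 0) :
    sqClass (x * t ^ 2) = sqClass x := by
  rw [sqClass_mul hx (pow_ne_zero 2 ht), sqClass_sq, mul_one]

/-- A rational solution of `y² = x³ + ax² + bx` is a nonsingular point of `E_{a,b}`. [cite: SilvermanTate2015, §3.5] -/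
private theorem nonsingular_of_eq' {a b x y : ℚ} [(⟨0, a, 0, b, 0⟩ : WeierstrassCurve ℚ).IsElliptic]
    (hy : y ^ 2 = x ^ 3 + a * x ^ 2 + b * x) : (⟨0, a, 0, b, 0⟩ : WeierstrassCurve ℚ).toAffine.Nonsingular x y := by
  refine Affine.equation_iff_nonsingular.mp ?_
  rw [Affine.equation_iff]
  show y ^ 2 + 0 * x * y + 0 * y = x ^ 3 + a * x ^ 2 + b * x + 0
  linear_combination hy

/-- A rational point `(x, y)`, `x ≠ 0`, of `E_{a,b}` puts `[x]` into `α(E_{a,b}(ℚ))`. [cite: SilvermanTate2015, §3.5] -/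
private theorem sqClass_mem_range_of_eq' {a b x y : ℚ} [(⟨0, a, 0, b, 0⟩ : WeierstrassCurve ℚ).IsElliptic]
    (hy : y ^ 2 = x ^ 3 + a * x ^ 2 + b * x) (hx : x ≠ 0) :
    sqClass x ∈ Set.range (⟨0, a, 0, b, 0⟩ : WeierstrassCurve ℚ).xSqClass :=
  ⟨.some x y (nonsingular_of_eq' hy), xSqClass_some_of_ne_zero _ hx⟩

/-- **`#α ≥ 4`** on `[0, -230, 0, -2400, 0]`: `[1]`, `α(T) = [-2400] = [-6]`, `α((-10), 0) = [-10]` and products. [cite: SilvermanTate2015, §3.5–§3.6] -/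
theorem card_range_xSqClass_M10_ge :
    (Set.range (⟨0, -230, 0, -2400, 0⟩ : WeierstrassCurve ℚ).xSqClass).Finite ∧
      4 ≤ Nat.card (Set.range (⟨0, -230, 0, -2400, 0⟩ : WeierstrassCurve ℚ).xSqClass) := by
  haveI := isElliptic_M10
  set W := (⟨0, -230, 0, -2400, 0⟩ : WeierstrassCurve ℚ) with hW
  have hfin : (Set.range W.xSqClass).Finite := by
    have h := (natCard_range_xSqClass_le (a := -230) (b := -2400) habM10).1
    have e : (⟨0, ((-230 : ℤ) : ℚ), 0, ((-2400 : ℤ) : ℚ), 0⟩ : WeierstrassCurve ℚ) = W := by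
      rw [hW]; ext <;> push_cast <;> ring
    rw [e] at h
    exact h
  refine ⟨hfin, ?_⟩
  have hs1 : sqClass (((1 : ℤ)) : ℚ) ∈ Set.range W.xSqClass := by
    refine ⟨0, ?_⟩
    rw [xSqClass_zero, Int.cast_one]
    exact ((sqClass_eq_one_iff one_ne_zero).mpr ⟨1, by norm_num⟩).symm
  have hsm6 : sqClass (((-6 : ℤ)) : ℚ) ∈ Set.range W.xSqClass := by
    refine ⟨W.twoTorsionPoint, ?_⟩
    rw [xSqClass_twoTorsionPoint]
    show sqClass (-2400 : ℚ) = _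
    rw [show (-2400 : ℚ) = -6 * 20 ^ 2 by norm_num, sqClass_mul_sq' (by norm_num) (by norm_num)]
    push_cast
    rfl
  have hsm10 : sqClass (((-10 : ℤ)) : ℚ) ∈ Set.range W.xSqClass := by
    have h := sqClass_mem_range_of_eq' (a := -230) (b := -2400) (x := (-10)) (y := 0)
      (by norm_num) (by norm_num)
    rwa [show ((-10) : ℚ) = -10 * (1) ^ 2 by norm_num, sqClass_mul_sq' (by norm_num) (by norm_num),
      show (-10 : ℚ) = ((-10 : ℤ) : ℚ) by norm_num] at h
  have hs15 : sqClass (((15 : ℤ)) : ℚ) ∈ Set.range W.xSqClass := by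
    have h := mul_mem_range_xSqClass W hsm6 hsm10
    rwa [← sqClass_mul (by norm_num) (by norm_num), ← Int.cast_mul,
      show ((-6 : ℤ) * -10 : ℤ) = 15 * 2 ^ 2 by norm_num, Int.cast_mul,
      show (((2 ^ 2 : ℤ)) : ℚ) = (2 : ℚ) ^ 2 by norm_num, sqClass_mul_sq' (by norm_num) (by norm_num)] at h
  have hsqf : ∀ d ∈ ({1, -6, -10, 15} : Finset ℤ), Squarefree d := by
    intro d hd
    simp only [Finset.mem_insert, Finset.mem_singleton] at hd
    rcases hd with rfl | rfl | rfl | rfl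
    · exact squarefree_int_of_natAbs (n := 1) rfl one_ne_zero (by simp)
    · exact squarefree_int_of_natAbs (n := 6) rfl (by norm_num) (by simp)
    · exact squarefree_int_of_natAbs (n := 10) rfl (by norm_num) (by simp)
    · exact squarefree_int_of_natAbs (n := 15) rfl (by norm_num) (by simp)
  have hsub : (↑(({1, -6, -10, 15} : Finset ℤ).image fun d : ℤ => sqClass (d : ℚ)) :
      Set (SqUnits ℚ)) ⊆ Set.range W.xSqClass := by
    intro c hc
    obtain ⟨d, hd, rfl⟩ := Finset.mem_image.mp (Finset.mem_coe.mp hc)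
    simp only [Finset.mem_insert, Finset.mem_singleton] at hd
    rcases hd with rfl | rfl | rfl | rfl
    · exact hs1
    · exact hsm6
    · exact hsm10
    · exact hs15
  have hcard : (({1, -6, -10, 15} : Finset ℤ).image fun d : ℤ => sqClass (d : ℚ)).card = 4 := by
    rw [Finset.card_image_of_injOn (fun d₁ h₁ d₂ h₂ he =>
      eq_of_sqClass_intCast_eq (hsqf d₁ h₁) (hsqf d₂ h₂) he)]
    rfl
  calc 4 = (↑(({1, -6, -10, 15} : Finset ℤ).image fun d : ℤ => sqClass (d : ℚ)) :
        Set (SqUnits ℚ)).ncard := by rw [Set.ncard_coe_finset, hcard]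
    _ ≤ (Set.range W.xSqClass).ncard := Set.ncard_le_ncard hsub hfin
    _ = Nat.card (Set.range W.xSqClass) := (Nat.card_coe_set_eq _).symm

/-- **`#α(M₁₀(ℚ)) = 4` and `#ᾱ(W(ℚ)) = 1`**: `#α·#ᾱ = 2^{rank+2} = 4` (`natCard_range_xSqClass_mul`, rank `0`) with `#α ≥ 4`.
[cite: SilvermanTate2015, §3.6 (2^r = #α(Γ)·#ᾱ(Γ̄)/4)] -/
theorem card_range_xSqClass_M10_W :
    Nat.card (Set.range (⟨0, -230, 0, -2400, 0⟩ : WeierstrassCurve ℚ).xSqClass) = 4 ∧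
      Nat.card (Set.range (⟨0, 460, 0, 62500, 0⟩ : WeierstrassCurve ℚ).xSqClass) = 1 := by
  haveI := isElliptic_M10
  have hmul := (⟨0, -230, 0, -2400, 0⟩ : WeierstrassCurve ℚ).natCard_range_xSqClass_mul
  rw [twoIsogenyCodomain_M10, mordellWeilRank_M10] at hmul
  have hmul4 : Nat.card (Set.range (⟨0, -230, 0, -2400, 0⟩ : WeierstrassCurve ℚ).xSqClass) *
      Nat.card (Set.range (⟨0, 460, 0, 62500, 0⟩ : WeierstrassCurve ℚ).xSqClass) = 4 := hmul
  have h4 := card_range_xSqClass_M10_ge.2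
  set A := Nat.card (Set.range (⟨0, -230, 0, -2400, 0⟩ : WeierstrassCurve ℚ).xSqClass) with hA
  set B := Nat.card (Set.range (⟨0, 460, 0, 62500, 0⟩ : WeierstrassCurve ℚ).xSqClass) with hB
  have hB1 : 1 ≤ B := by
    rcases Nat.eq_zero_or_pos B with h0 | hpos
    · rw [h0, mul_zero] at hmul4; omega
    · exact hpos
  have hB2 : B ≤ 1 := by
    by_contra hlt
    have : 8 ≤ A * B := by nlinarith
    omega
  have hBe : B = 1 := le_antisymm hB2 hB1
  rw [hBe, mul_one] at hmul4
  exact ⟨hmul4, hBe⟩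

/-! ## §3 The bracket: `#Ш(V₀/ℚ)[φ] = 2`, `1 ≤ #Ш(M₁₀/ℚ)[φ] ≤ 2` -/

/-- **`#(Ш(V₀/ℚ) ∩ im Ξ_{V₀}) = 2`**: `2^{dim₂ S(−230,−2400)} = #α(M₁₀(ℚ)) · #(Ш(V₀) ∩ im Ξ_{V₀})` (half-model count) with `8 = 4 · 2`.
So `Ш(V₀/ℚ)[φ] ≅ ℤ/2`: an isogeny-Sha of NON-square order. [cite: SilvermanAEC2009, Thm. X.4.2(a) and Prop. X.4.9] -/
theorem natCard_sha_inf_range_V₀ [hV : (⟨0, 115, 0, 15625 / 4, 0⟩ : WeierstrassCurve ℚ).IsElliptic] :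
    Nat.card ↥((⟨0, 115, 0, 15625 / 4, 0⟩ : WeierstrassCurve ℚ).sha ⊓
        AddMonoidHom.range (G := Additive (SqUnits ℚ)) (⟨0, 115, 0, 15625 / 4, 0⟩ : WeierstrassCurve ℚ).twoIsogenyTorsorHom) = 2 := by
  haveI hV₀ : (⟨0, -((-230 : ℤ) : ℚ) / 2, 0, (((-230 : ℤ) : ℚ) ^ 2 - 4 * (-2400 : ℤ)) / 16, 0⟩ :
      WeierstrassCurve ℚ).IsElliptic := by rw [lit_V₀]; exact hV
  have key := two_pow_twoIsogenySelmerRank_eq_natCard_mul_halfModel (a := -230) (b := -2400) habM10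
  rw [natCard_sha_inf_range_twoIsogenyTorsorHom_congr lit_V₀, twoIsogenySelmerRank_M10_eq, lit_M10,
    card_range_xSqClass_M10_W.1] at key
  omega

/-- **`1 ≤ #(Ш(M₁₀/ℚ) ∩ im Ξ_{M₁₀}) ≤ 2`**: `2^{dim₂ S(460,62500)} = #ᾱ(W(ℚ)) · #(Ш(M₁₀) ∩ im Ξ_{M₁₀}) = 1 · #(…)` with
`dim₂ ≤ 1`. (Whether it is `1` or `2` — i.e. whether the class `10` is everywhere locally soluble — is decided by PARITY in the
Summits sequel, not by local points here.) [cite: SilvermanAEC2009, Thm. X.4.2(a) and Prop. X.4.9] -/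
theorem natCard_sha_inf_range_M10 [hE : (⟨0, -230, 0, -2400, 0⟩ : WeierstrassCurve ℚ).IsElliptic] :
    1 ≤ Nat.card ↥((⟨0, -230, 0, -2400, 0⟩ : WeierstrassCurve ℚ).sha ⊓
        AddMonoidHom.range (G := Additive (SqUnits ℚ)) (⟨0, -230, 0, -2400, 0⟩ : WeierstrassCurve ℚ).twoIsogenyTorsorHom) ∧
      Nat.card ↥((⟨0, -230, 0, -2400, 0⟩ : WeierstrassCurve ℚ).sha ⊓
        AddMonoidHom.range (G := Additive (SqUnits ℚ)) (⟨0, -230, 0, -2400, 0⟩ : WeierstrassCurve ℚ).twoIsogenyTorsorHom) ≤ 2 ∧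
      2 ^ twoIsogenySelmerRank' (-230) (-2400) =
        Nat.card ↥((⟨0, -230, 0, -2400, 0⟩ : WeierstrassCurve ℚ).sha ⊓
          AddMonoidHom.range (G := Additive (SqUnits ℚ)) (⟨0, -230, 0, -2400, 0⟩ : WeierstrassCurve ℚ).twoIsogenyTorsorHom) := by
  haveI hE' : (⟨0, ((-230 : ℤ) : ℚ), 0, ((-2400 : ℤ) : ℚ), 0⟩ : WeierstrassCurve ℚ).IsElliptic := by rw [lit_M10]; exact hE
  have key := two_pow_twoIsogenySelmerRank'_eq_natCard_mul (a := -230) (b := -2400) habM10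
  rw [lit_W, card_range_xSqClass_M10_W.2, one_mul, natCard_sha_inf_range_twoIsogenyTorsorHom_congr lit_M10] at key
  have hle : 2 ^ twoIsogenySelmerRank' (-230) (-2400) ≤ 2 ^ 1 := Nat.pow_le_pow_right (by norm_num) twoIsogenySelmerRank'_M10_le
  have hpos : 1 ≤ 2 ^ twoIsogenySelmerRank' (-230) (-2400) := Nat.one_le_two_pow
  refine ⟨by omega, by omega, key⟩

end Curve2000

end Literature.NumberTheory.EllipticCurves

end
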